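/-
Copyright (c) 2026 the pub-hodgecm-mathlib formalisation cell (harness21).  Prover seat hodgecm-mathlib-K2E1-p08 (g2), Track B ∕ K2-LIT
(build stream 29), h413 = `stmt-HodgeConjecture-24833`, line `K2_E1_TraceFormulaBeta`; BY-NAME DEAL of the dealer K2E1-plan (g0)
2026-09-03T23:02:11Z: `Theorems/K2E1SupercuspidalUnipotentPeriodVanishing.lean` (the `hcu` token of the dealer's ruling (α) on the (H1)∕(H2) docking).
-/
import Summits.HodgeConjecture.HodgeConjecture.Theorems.K2E1UnipotentExhaustionU2               -- ★ p855389: exhaustion of `N_v`; brings ★ p855328 (Jacquet vanishing), ★ p855253, ★ `U3SupercuspFormUnipotentIntegral` §1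
import Summits.HodgeConjecture.HodgeConjecture.Theorems.F0P3bCentralCharacterUnitaryNonsplit    -- ★ `isCompact_center_cmLocal_of_nonsplit` (the centre of `U(Φ_N)(L⁺_v)` is compact at a non-split `v`)
import Summits.HodgeConjecture.HodgeConjecture.Theorems.K2E1PoincareSeriesCuspidalGlueU2         -- ★ p855468 §1: `hasCompactSupport_translate_inv` (and the `hloc` shape this file feeds)
import HarnessLib

/-!
# K2·E1 — `K2E1SupercuspidalUnipotentPeriodVanishing`: the UNIPOTENT PERIODS `∫_N c(x n⁻¹ y) dn` of a compactly supported matrix coefficient VANISH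
# when the `N`-coinvariants vanish and `N` is exhausted by compact open subgroups (Jacquet's lemma); the `U(Φ₂)(L⁺_v)` supercuspidal instance = the token `hcu`

Track B ∕ K2-LIT, crux h413 = `stmt-HodgeConjecture-24833`, route of record `HCCMUnconditional`; cell `hodgecm-mathlib`, squad K2; prover seat
`hodgecm-mathlib-K2E1-p08` (g2), BY-NAME DEAL of the dealer K2E1-plan (g0) 2026-09-03T23:02:11Z; lane `--supports stmt-HodgeConjecture-24833 --as helper`
(count-neutral).  THEOREMS ONLY (no `def`, no `instance`, no notation, no named-fact hypothesis, no `sorry`).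

THE MATHEMATICS [HarishChandra1970 Part I §3 p. 9 (supercusp forms: (ii) `∫_N f(x n) dn = 0`; matrix coefficients of supercuspidal representations are
supercusp forms); Casselman1995 Prop. 1.4.4, Thm. 5.3.1; Rogawski1990 §13.8 p. 218 (i)–(iii)].  JACQUET'S LEMMA: `G` a Hausdorff topological group, `N ≤ G` a
CLOSED subgroup EXHAUSTED by compact open subgroups (`∀ C ⊆ N` compact, `∃ U ≤ N` compact open subgroup, `C ⊆ U`), `ν` a LEFT-invariant measure on `N` finite
on compacta, `ρ` SMOOTH on `V` with vanishing `N`-coinvariants (`V = V(N) = ⟨ρ(n)x − x⟩`), and a matrix coefficient `c = c_{φ,v} : g ↦ φ(ρ(g) v)` (★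
`Representation.matrixCoeff`) with COMPACT SUPPORT on `G`.  Then `∫_N c(x n⁻¹ y) dν(n) = 0` for all `x, y ∈ G`: the integrand `n ↦ φ(ρ(x) ρ(n⁻¹) ρ(y) v)` is
continuous (locally constant, smoothness) with compact support on the closed `N`; substituting `n ↦ n⁻¹` turns `ν` into the RIGHT-invariant `ν⁻¹` (Mathlib
`Measure.inv`) and the integral into `∫_N φ(ρ(x m) w) dν⁻¹(m)`, `w = ρ(y) v ∈ V(N)`; Jacquet's first lemma (★ `exists_finset_forall_setIntegral_dual_apply_eq_zero_of_mem_span`: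
a finite `S ⊆ N` with `∫_U φ(ρ(x m) w) dν⁻¹ = 0` for every compact open subgroup `U ⊇ S`) and a compact open subgroup `U ⊇ supp ∪ S` (exhaustion) finish.
No smoothness of `φ` is needed; for `ρ` SUPERCUSPIDAL (★ `Representation.IsSupercuspidal`), `Z(G)` compact and `φ` smooth the compact support is automatic
(★ `IsSupercuspidal.hasCompactSupport_matrixCoeff`).

CONTENT.
* §1 generic `G`, `N`, left-invariant `ν` on `↥N`: `exists_compactOpen_subgroup_of_exhaustion_seq` (the ★ p855389 sequence currency `N_j` ⇒ the compact-exhaustion currency),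
  `forall_mem_span_of_subsingleton_coinvariants_comp` (`Subsingleton (ρ|_N)`-coinvariants ⇒ `V = V(N)`, Mathlib `Representation.Coinvariants`),
  `continuous_dual_apply_translate_inv`, `hasCompactSupport_dual_apply_translate_inv`, the HEAD **`integral_matrixCoeff_translate_inv_eq_zero`** (hypotheses: `ρ` smooth,
  `N` closed + exhausted, `V = V(N)`, `HasCompactSupport c`), its `Subsingleton`-coinvariants and `N_j`-sequence readings, the SUPERCUSPIDAL reading
  `integral_matrixCoeff_translate_inv_eq_zero_of_isSupercuspidal` (`φ ∈ ρ.contragredient`, `Z(G)` compact), and the SESQUILINEAR currency of ★ p855253 ∕ ★ p855471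
  (`c_x(g) = B (ρ g u) x`, `B` `G`-invariant Hermitian): `integral_sesqForm_apply_translate_inv_eq_zero_of_isSupercuspidal`, `integral_sesqForm_translate_inv_apply_eq_zero_of_isSupercuspidal`.
* §2 THE INSTANCE `G_v = U(Φ₂)(L⁺_v) = ↥(unitaryGroupOfForm (conjLocal L c v) (cmLocalForm L 2 v))` (= `(cmDatum L 2 Φ₂).Local v`, ★ `cmDatum_Local_eq`), `v` NON-SPLIT in `L`,
  `N_v = (cmBorelTriple L 2 v).N`: every input is ★ — exhaustion ★ p855389 `cm_exists_compactOpen_subgroups_exhausting_cmBorelN_two`, Jacquet vanishing ★ p855328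
  `cm_forall_mem_span_sub_of_isSupercuspidal_two`, closedness ★ p855253 `isClosed_coe_cmBorelTriple_N`, compact centre ★ `isCompact_center_cmLocal_of_nonsplit` — so for a
  smooth SUPERCUSPIDAL `ρ` of `G_v`, EVERY matrix coefficient `c_u` satisfies **`∀ x y, ∫_{N_v} c_u (x n⁻¹ y) dν(n) = 0`** for every left-invariant `ν` finite on compacta:
  **`cm_integral_matrixCoeff_translate_inv_cmBorelN_two_eq_zero`** (linear-form currency), **`cm_integral_sesqForm_translate_inv_apply_cmBorelN_two_eq_zero`** (the
  `c_x(g) = B (ρ g u) x` currency of ★ p855471 `K2E1PoincareSeriesH1Package`), `cm_integral_idempotent_translate_inv_cmBorelN_two_eq_zero` (`e = c · B(ρ(·)u) u`, ★ p855188).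
  This is the LOCAL hypothesis `hcu : ∀ x y : G_v, ∫ n : ↥N_v, c_u (x * (n:G_v)⁻¹ * y) ∂ν_N = 0` of the dealer's ruling (α) (K2∕STATUS 2026-09-03T23:02:11Z), from which
  K2E1-p07 (g2) derives the `hloc` of ★ p855468 §1 `integral_translate_inv_eq_zero_of_subgroup` for the pure tensor `c_u ⊗ 𝟙_{K^v} ⊗ f_∞`.

HONEST LABEL: HC_CM is proved only modulo the 7 printed citations (2 remaining named inputs: hLiu418 = `stmt-HodgeConjecture-24832`, h413 =
`stmt-HodgeConjecture-24833`) until rung 0 closes; this file moves no counter and closes no socket.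

## References
* [HarishChandra1970] Harish-Chandra (notes by G. van Dijk), *Harmonic Analysis on Reductive p-adic Groups*, LNM 162 (1970), Part I §3 p. 9.
* [Casselman1995] W. Casselman, *Introduction to the theory of admissible representations of p-adic reductive groups* (1995), Prop. 1.4.4, Thm. 5.3.1.
* [BernsteinZelevinsky1977] I. N. Bernstein, A. V. Zelevinsky, *Induced representations of reductive p-adic groups I*, Ann. Sci. ÉNS 10 (1977), §1.8.
* [Rogawski1990] J. D. Rogawski, *Automorphic Representations of Unitary Groups in Three Variables*, Ann. of Math. Stud. 123 (1990), §12.2 p. 173, §13.8 p. 218 (i)–(iii).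
* [Gelbart1975] S. Gelbart, *Automorphic forms on adele groups*, Ann. of Math. Stud. 83 (1975), §10 p. 153.
-/

set_option autoImplicit false
-- the mandated namespace repeats the single-problem summit's segment (`HodgeConjecture.HodgeConjecture`)
set_option linter.dupNamespace false

noncomputable section

open MeasureTheory Measure Set Filter Topology
open scoped ComplexConjugate
open Literature.NumberTheory.Automorphic
open Summit.HodgeConjecture.HodgeConjecture.Cruxes.H413.K2E1PoincareSeriesCuspidalGlueU2 (hasCompactSupport_translate_inv)

namespace Summit.HodgeConjecture.HodgeConjecture.Cruxes.H413.K2E1SupercuspidalUnipotentPeriodVanishing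

/-! ## §1 Generic group: Jacquet's lemma for the periods `∫_N c(x n⁻¹ y) dν(n)` against a left-invariant measure -/

section Generic

variable {G V : Type*} [Group G] [TopologicalSpace G] [IsTopologicalGroup G] [T2Space G] [AddCommGroup V] [Module ℂ V]
  (ρ : Representation ℂ G V) (N : Subgroup G) [MeasurableSpace ↥N] [BorelSpace ↥N]
  (ν : Measure ↥N) [IsFiniteMeasureOnCompacts ν] [ν.IsMulLeftInvariant]

/-- **The two exhaustion currencies.**  If a topological group `N` is the increasing union of compact open subgroups `N_j` (the sequence currency of ★ p855389
`cm_exists_compactOpen_subgroups_exhausting_cmBorelN_two`), then every compact `C ⊆ N` lies in a single compact open subgroup (directed open cover of a compact set).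
[cite: Casselman1995, Prop. 1.4.4] -/
theorem exists_compactOpen_subgroup_of_exhaustion_seq {N' : Type*} [Group N'] [TopologicalSpace N']
    (Nj : ℕ → Subgroup N') (hmono : Monotone Nj) (hc : ∀ j, IsCompact (Nj j : Set N')) (ho : ∀ j, IsOpen (Nj j : Set N'))
    (hex : ∀ n : N', ∃ j, n ∈ Nj j) {C : Set N'} (hC : IsCompact C) :
    ∃ U : Subgroup N', IsOpen (U : Set N') ∧ IsCompact (U : Set N') ∧ C ⊆ U := by
  have hdir : Directed (fun s t : Set N' => s ⊆ t) fun j => (Nj j : Set N') := fun i j =>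
    ⟨max i j, SetLike.coe_subset_coe.2 (hmono (le_max_left i j)), SetLike.coe_subset_coe.2 (hmono (le_max_right i j))⟩
  obtain ⟨j, hj⟩ := hC.elim_directed_cover (fun j => (Nj j : Set N')) ho (fun n _ => mem_iUnion.2 (hex n)) hdir
  exact ⟨Nj j, ho j, hc j, hj⟩

omit [TopologicalSpace G] [IsTopologicalGroup G] [T2Space G] [MeasurableSpace ↥N] [BorelSpace ↥N] in
/-- **Vanishing `N`-coinvariants ⇒ `V = V(N)`**: if the coinvariants of `ρ|_N = ρ.comp N.subtype` (Mathlib `Representation.Coinvariants`: `V ⧸ ⟨ρ(n)x − x⟩`) are a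
subsingleton, every vector lies in `⟨ρ(n)x − x : n ∈ N⟩` — the hypothesis currency `hJ` of ★ p855253 ∕ ★ `integral_dual_apply_eq_zero_of_mem_span_of_exhaustion`.
[cite: BernsteinZelevinsky1977, §1.8] -/
theorem forall_mem_span_of_subsingleton_coinvariants_comp (h : Subsingleton (Representation.Coinvariants (ρ.comp N.subtype))) (w : V) :
    w ∈ Submodule.span ℂ (Set.range fun p : ↥N × V => ρ (p.1 : G) p.2 - p.2) := by
  have h0 : Representation.Coinvariants.mk (ρ.comp N.subtype) w = 0 := Subsingleton.elim _ _
  rw [Representation.Coinvariants.mk_eq_zero] at h0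
  exact h0

omit [T2Space G] [MeasurableSpace ↥N] [BorelSpace ↥N] in
/-- For a smooth `ρ`, the inverted two-sided coefficient `n ↦ φ(ρ(x n⁻¹ y) v)` is CONTINUOUS on `N` (locally constant: ★ `isLocallyConstant_dual_apply_mul_subgroup`
composed with inversion). [cite: Casselman1995, Prop. 1.4.4] -/
theorem continuous_dual_apply_translate_inv (hρ : ρ.IsSmooth) (φ : Module.Dual ℂ V) (x y : G) (v : V) :
    Continuous fun n : ↥N => φ (ρ (x * (n : G)⁻¹ * y) v) := by
  have heq : (fun n : ↥N => φ (ρ (x * (n : G)⁻¹ * y) v)) = (fun m : ↥N => φ (ρ (x * m) (ρ y v))) ∘ fun n : ↥N => n⁻¹ := by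
    funext n
    simp only [Function.comp_apply, Subgroup.coe_inv, map_mul, Module.End.mul_apply]
  rw [heq]
  exact (isLocallyConstant_dual_apply_mul_subgroup ρ N hρ φ x (ρ y v)).continuous.comp continuous_inv

omit [T2Space G] [MeasurableSpace ↥N] [BorelSpace ↥N] in
/-- The inverted two-sided coefficient `n ↦ c(x n⁻¹ y)` of a compactly supported `c : G → ℂ` has COMPACT SUPPORT on the CLOSED subgroup `N` (★ p855468
`hasCompactSupport_translate_inv`, recorded in the matrix-coefficient spelling). [cite: HarishChandra1970, Part I §3 p. 9] -/
theorem hasCompactSupport_matrixCoeff_translate_inv (hN : IsClosed (N : Set G)) (φ : Module.Dual ℂ V) (v : V)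
    (hcs : HasCompactSupport (ρ.matrixCoeff φ v)) (x y : G) :
    HasCompactSupport fun n : ↥N => ρ.matrixCoeff φ v (x * (n : G)⁻¹ * y) :=
  hasCompactSupport_translate_inv N hN hcs x y

/-- **HEAD — JACQUET'S LEMMA FOR THE UNIPOTENT PERIODS OF A COMPACTLY SUPPORTED COEFFICIENT.**  `G` Hausdorff topological group, `N ≤ G` CLOSED and EXHAUSTED by compact open
subgroups (`hexh`), `ν` a LEFT-invariant measure on `N` finite on compacta, `ρ` SMOOTH with `V = V(N)` (`hJ`, e.g. from `forall_mem_span_of_subsingleton_coinvariants_comp`), and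
`c = ρ.matrixCoeff φ v` COMPACTLY SUPPORTED on `G`.  Then `∫_N c(x n⁻¹ y) dν(n) = 0` for all `x, y ∈ G`.  Proof: `n ↦ n⁻¹` carries `ν` to the right-invariant `ν⁻¹`
(Mathlib `Measure.inv`) and the integral to `∫_N φ(ρ(x m) w) dν⁻¹`, `w = ρ(y) v ∈ V(N)`; the integrand vanishes off a compact open subgroup `U ⊇ supp ∪ S` (`S` the finite set
of Jacquet's first lemma ★ `exists_finset_forall_setIntegral_dual_apply_eq_zero_of_mem_span`), over which the integral is `0`. [cite: HarishChandra1970, Part I §3 p. 9]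
[cite: Casselman1995, Thm. 5.3.1] -/
theorem integral_matrixCoeff_translate_inv_eq_zero (hρ : ρ.IsSmooth) (hN : IsClosed (N : Set G))
    (hexh : ∀ C : Set ↥N, IsCompact C → ∃ U : Subgroup ↥N, IsOpen (U : Set ↥N) ∧ IsCompact (U : Set ↥N) ∧ C ⊆ U)
    (hJ : ∀ w : V, w ∈ Submodule.span ℂ (Set.range fun p : ↥N × V => ρ (p.1 : G) p.2 - p.2))
    (φ : Module.Dual ℂ V) (v : V) (hcs : HasCompactSupport (ρ.matrixCoeff φ v)) (x y : G) :
    ∫ n : ↥N, ρ.matrixCoeff φ v (x * (n : G)⁻¹ * y) ∂ν = 0 := by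
  -- the un-inverted coefficient `g m = φ(ρ(x m) w)`, `w = ρ(y) v`; the integrand is `g ∘ inv`
  set g : ↥N → ℂ := fun m => φ (ρ (x * m) (ρ y v)) with hg
  have hfg : (fun n : ↥N => ρ.matrixCoeff φ v (x * (n : G)⁻¹ * y)) = g ∘ (MeasurableEquiv.inv ↥N) := by
    funext n
    simp only [hg, Function.comp_apply, MeasurableEquiv.inv_apply, Representation.matrixCoeff_apply, Subgroup.coe_inv, map_mul,
      Module.End.mul_apply]
  -- `g` is continuous with compact support (it is the integrand composed with the homeomorphism `inv`)
  have hgc : Continuous g := (isLocallyConstant_dual_apply_mul_subgroup ρ N hρ φ x (ρ y v)).continuous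
  have hgs : HasCompactSupport g := by
    have h1 : g = (fun n : ↥N => ρ.matrixCoeff φ v (x * (n : G)⁻¹ * y)) ∘ (Homeomorph.inv ↥N) := by
      funext m
      simp only [hg, Function.comp_apply, Homeomorph.coe_inv, Representation.matrixCoeff_apply, Subgroup.coe_inv, inv_inv, map_mul,
        Module.End.mul_apply]
    rw [h1]
    exact (hasCompactSupport_matrixCoeff_translate_inv ρ N hN φ v hcs x y).comp_homeomorph _
  -- the inverted measure is right-invariant and finite on compacta
  haveI : IsFiniteMeasureOnCompacts ν.inv := by
    rw [Measure.inv_def]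
    exact IsFiniteMeasureOnCompacts.map ν (Homeomorph.inv ↥N)
  -- Jacquet's first lemma against `ν⁻¹`, and a compact open subgroup containing `tsupport g ∪ S`
  obtain ⟨S, hS⟩ := exists_finset_forall_setIntegral_dual_apply_eq_zero_of_mem_span ρ N ν.inv hρ (hJ (ρ y v))
  obtain ⟨U, hUo, hUc, hU⟩ := hexh (tsupport g ∪ (S : Set ↥N)) (hgs.isCompact.union S.finite_toSet.isCompact)
  -- substitute `n ↦ n⁻¹`, restrict to `U`, conclude
  have h1 : ∫ n : ↥N, (g ∘ (MeasurableEquiv.inv ↥N)) n ∂ν = ∫ m, g m ∂ν.inv := by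
    rw [Measure.inv_def]
    exact (integral_map_equiv (MeasurableEquiv.inv ↥N) g).symm
  have h2 : ∫ m, g m ∂ν.inv = ∫ m in (U : Set ↥N), g m ∂ν.inv :=
    (setIntegral_eq_integral_of_forall_compl_eq_zero fun m hm => image_eq_zero_of_notMem_tsupport fun h => hm (hU (Or.inl h))).symm
  rw [hfg, h1, h2]
  exact hS U (fun s hs => hU (Or.inr hs)) hUc hUo φ x

/-- **HEAD, `Subsingleton`-coinvariants reading** (the currency of ★ p855328 `cm_coinvariants_subsingleton_of_isSupercuspidal_two`, here for the restriction `ρ.comp N.subtype`):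
`∫_N c(x n⁻¹ y) dν = 0` for a compactly supported matrix coefficient `c` of a smooth `ρ` whose `N`-coinvariants vanish, `N` closed and exhausted by compact open subgroups.
[cite: HarishChandra1970, Part I §3 p. 9] [cite: Casselman1995, Thm. 5.3.1] -/
theorem integral_matrixCoeff_translate_inv_eq_zero_of_subsingleton (hρ : ρ.IsSmooth) (hN : IsClosed (N : Set G))
    (hexh : ∀ C : Set ↥N, IsCompact C → ∃ U : Subgroup ↥N, IsOpen (U : Set ↥N) ∧ IsCompact (U : Set ↥N) ∧ C ⊆ U)
    (hcoinv : Subsingleton (Representation.Coinvariants (ρ.comp N.subtype)))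
    (φ : Module.Dual ℂ V) (v : V) (hcs : HasCompactSupport (ρ.matrixCoeff φ v)) (x y : G) :
    ∫ n : ↥N, ρ.matrixCoeff φ v (x * (n : G)⁻¹ * y) ∂ν = 0 :=
  integral_matrixCoeff_translate_inv_eq_zero ρ N ν hρ hN hexh (forall_mem_span_of_subsingleton_coinvariants_comp ρ N hcoinv) φ v hcs x y

/-- **HEAD, sequence-exhaustion reading** (the `N_j` currency of ★ p855389 ∕ ★ p855253): `∫_N c(x n⁻¹ y) dν = 0`. [cite: HarishChandra1970, Part I §3 p. 9] [cite: Casselman1995, Thm. 5.3.1] -/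
theorem integral_matrixCoeff_translate_inv_eq_zero_of_exhaustion_seq (hρ : ρ.IsSmooth) (hN : IsClosed (N : Set G))
    (Nj : ℕ → Subgroup ↥N) (hmono : Monotone Nj) (hc : ∀ j, IsCompact (Nj j : Set ↥N)) (ho : ∀ j, IsOpen (Nj j : Set ↥N))
    (hex : ∀ n : ↥N, ∃ j, n ∈ Nj j)
    (hJ : ∀ w : V, w ∈ Submodule.span ℂ (Set.range fun p : ↥N × V => ρ (p.1 : G) p.2 - p.2))
    (φ : Module.Dual ℂ V) (v : V) (hcs : HasCompactSupport (ρ.matrixCoeff φ v)) (x y : G) :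
    ∫ n : ↥N, ρ.matrixCoeff φ v (x * (n : G)⁻¹ * y) ∂ν = 0 :=
  integral_matrixCoeff_translate_inv_eq_zero ρ N ν hρ hN (fun _ hC => exists_compactOpen_subgroup_of_exhaustion_seq Nj hmono hc ho hex hC) hJ φ v hcs x y

/-- **SUPERCUSPIDAL reading**: for `ρ` smooth SUPERCUSPIDAL (★ `Representation.IsSupercuspidal`: smooth coefficients supported in `C · Z(G)`), `Z(G)` COMPACT and `φ` a SMOOTH
linear form (`φ ∈ ρ.contragredient`), the compact support is automatic (★ `IsSupercuspidal.hasCompactSupport_matrixCoeff`): `∫_N φ(ρ(x n⁻¹ y) v) dν = 0` along every closed `N`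
exhausted by compact open subgroups with `V = V(N)` — Harish-Chandra's cusp condition (ii) for the coefficients of a supercuspidal representation.
[cite: HarishChandra1970, Part I §3 p. 9] [cite: Casselman1995, Thm. 5.3.1] -/
theorem integral_matrixCoeff_translate_inv_eq_zero_of_isSupercuspidal (hρ : ρ.IsSmooth) (hsc : ρ.IsSupercuspidal)
    (hZ : IsCompact (Subgroup.center G : Set G)) (hN : IsClosed (N : Set G))
    (hexh : ∀ C : Set ↥N, IsCompact C → ∃ U : Subgroup ↥N, IsOpen (U : Set ↥N) ∧ IsCompact (U : Set ↥N) ∧ C ⊆ U)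
    (hJ : ∀ w : V, w ∈ Submodule.span ℂ (Set.range fun p : ↥N × V => ρ (p.1 : G) p.2 - p.2))
    {φ : Module.Dual ℂ V} (hφ : φ ∈ ρ.contragredient) (v : V) (x y : G) :
    ∫ n : ↥N, φ (ρ (x * (n : G)⁻¹ * y) v) ∂ν = 0 := by
  have h := integral_matrixCoeff_translate_inv_eq_zero ρ N ν hρ hN hexh hJ φ v (hsc.hasCompactSupport_matrixCoeff hZ hφ v) x y
  simpa only [Representation.matrixCoeff_apply] using h

variable {B : V →ₗ⋆[ℂ] V →ₗ[ℂ] ℂ}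

/-- **Sesquilinear currency, linear slot** (`B` `G`-invariant, so `B u' ∈ Ṽ` by ★ `sesqForm_apply_mem_contragredient`): `∫_N B u' (ρ(x n⁻¹ y) u) dν = 0` for smooth
supercuspidal `ρ`, `Z(G)` compact, `N` closed exhausted with `V = V(N)`. [cite: HarishChandra1970, Part I §3 p. 9] -/
theorem integral_sesqForm_apply_translate_inv_eq_zero_of_isSupercuspidal (hρ : ρ.IsSmooth) (hsc : ρ.IsSupercuspidal)
    (hZ : IsCompact (Subgroup.center G : Set G)) (hBinv : ∀ (g : G) (v w : V), B (ρ g v) (ρ g w) = B v w) (hN : IsClosed (N : Set G))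
    (hexh : ∀ C : Set ↥N, IsCompact C → ∃ U : Subgroup ↥N, IsOpen (U : Set ↥N) ∧ IsCompact (U : Set ↥N) ∧ C ⊆ U)
    (hJ : ∀ w : V, w ∈ Submodule.span ℂ (Set.range fun p : ↥N × V => ρ (p.1 : G) p.2 - p.2)) (x y : G) (u u' : V) :
    ∫ n : ↥N, B u' (ρ (x * (n : G)⁻¹ * y) u) ∂ν = 0 :=
  integral_matrixCoeff_translate_inv_eq_zero_of_isSupercuspidal ρ N ν hρ hsc hZ hN hexh hJ
    (Representation.sesqForm_apply_mem_contragredient hρ B hBinv u') u x y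

/-- **Sesquilinear currency, conjugate-linear slot** — the `c_x(g) = B (ρ g u) x` coefficients of ★ p855471 `K2E1PoincareSeriesH1Package` (`B` Hermitian, ★ `LinearMap.IsSymm`,
`integral_conj`): `∫_N B (ρ(x n⁻¹ y) u) u' dν = 0`. [cite: HarishChandra1970, Part I §3 p. 9] -/
theorem integral_sesqForm_translate_inv_apply_eq_zero_of_isSupercuspidal (hρ : ρ.IsSmooth) (hsc : ρ.IsSupercuspidal)
    (hZ : IsCompact (Subgroup.center G : Set G)) (hBsymm : B.IsSymm) (hBinv : ∀ (g : G) (v w : V), B (ρ g v) (ρ g w) = B v w) (hN : IsClosed (N : Set G))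
    (hexh : ∀ C : Set ↥N, IsCompact C → ∃ U : Subgroup ↥N, IsOpen (U : Set ↥N) ∧ IsCompact (U : Set ↥N) ∧ C ⊆ U)
    (hJ : ∀ w : V, w ∈ Submodule.span ℂ (Set.range fun p : ↥N × V => ρ (p.1 : G) p.2 - p.2)) (x y : G) (u u' : V) :
    ∫ n : ↥N, B (ρ (x * (n : G)⁻¹ * y) u) u' ∂ν = 0 := by
  have heq : ∀ n : ↥N, B (ρ (x * (n : G)⁻¹ * y) u) u' = conj (B u' (ρ (x * (n : G)⁻¹ * y) u)) := fun n => (hBsymm.eq u' (ρ (x * (n : G)⁻¹ * y) u)).symm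
  simp_rw [heq]
  rw [integral_conj, integral_sesqForm_apply_translate_inv_eq_zero_of_isSupercuspidal ρ N ν hρ hsc hZ hBinv hN hexh hJ x y u u', map_zero]

end Generic

/-! ## §2 The instance `G_v = U(Φ₂)(L⁺_v)` at a NON-SPLIT place, `N_v = (cmBorelTriple L 2 v).N`: the token `hcu`, every input ★ -/

section CM

open NumberField IsDedekindDomain Literature.NumberTheory.Automorphic.UnitaryGroup
open Summit.HodgeConjecture.HodgeConjecture.Cruxes.H413.K2E1SupercuspidalJacquetVanishingU2 (cm_forall_mem_span_sub_of_isSupercuspidal_two)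
open Summit.HodgeConjecture.HodgeConjecture.Cruxes.H413.K2E1UnipotentExhaustionU2 (cm_exists_compactOpen_subgroups_exhausting_cmBorelN_two)
open Summit.HodgeConjecture.HodgeConjecture.Cruxes.H413.F0P3bCentralCharacterUnitaryNonsplit (isCompact_center_cmLocal_of_nonsplit)

variable (L : Type) [Field L] [NumberField L] [IsCMField L] (v : HeightOneSpectrum (𝓞 ↥(maximalRealSubfield L)))

/-- **`N_v` is exhausted by compact open subgroups, compact-exhaustion currency** (from ★ p855389's sequence `N_j`). [cite: Casselman1995, Prop. 1.4.4] [cite: Rogawski1990, §13.8 p. 218 (i)–(iii)] -/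
theorem cm_exists_compactOpen_subgroup_cmBorelN_two (hns : ∀ w : PlacesOver L v, IsCMField.complexConj L • w.1 = w.1)
    {C : Set ↥(cmBorelTriple L 2 v).N} (hC : IsCompact C) :
    ∃ U : Subgroup ↥(cmBorelTriple L 2 v).N, IsOpen (U : Set ↥(cmBorelTriple L 2 v).N) ∧ IsCompact (U : Set ↥(cmBorelTriple L 2 v).N) ∧ C ⊆ U := by
  obtain ⟨Nj, hmono, hc, ho, hex⟩ := cm_exists_compactOpen_subgroups_exhausting_cmBorelN_two L v hns
  exact exists_compactOpen_subgroup_of_exhaustion_seq Nj hmono hc ho hex hC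

/-- **THE TOKEN `hcu`, LINEAR-FORM CURRENCY.**  `L` CM, `v` a finite place of `L⁺` NON-SPLIT in `L`, `G_v = U(Φ₂)(L⁺_v)`, `N_v = (cmBorelTriple L 2 v).N` with ANY left-invariant
measure `ν` finite on compacta, `ρ` smooth SUPERCUSPIDAL on `V`, `φ ∈ ρ.contragredient`, `u ∈ V`, `c_u = ρ.matrixCoeff φ u`: **`∀ x y, ∫_{N_v} c_u (x n⁻¹ y) dν(n) = 0`** —
UNCONDITIONAL: exhaustion ★ p855389, Jacquet vanishing ★ p855328, `N_v` closed ★ p855253, compact centre ★ `isCompact_center_cmLocal_of_nonsplit`.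
[cite: HarishChandra1970, Part I §3 p. 9] [cite: Casselman1995, Thm. 5.3.1] [cite: Rogawski1990, §12.2 p. 173; §13.8 p. 218 (i)–(iii)] -/
theorem cm_integral_matrixCoeff_translate_inv_cmBorelN_two_eq_zero (hns : ∀ w : PlacesOver L v, IsCMField.complexConj L • w.1 = w.1)
    [MeasurableSpace ↥(cmBorelTriple L 2 v).N] [BorelSpace ↥(cmBorelTriple L 2 v).N]
    (ν : Measure ↥(cmBorelTriple L 2 v).N) [IsFiniteMeasureOnCompacts ν] [ν.IsMulLeftInvariant]
    {V : Type*} [AddCommGroup V] [Module ℂ V]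
    (ρ : Representation ℂ ↥(unitaryGroupOfForm (conjLocal L (IsCMField.complexConj L) v) (cmLocalForm L 2 v)) V)
    (hρ : ρ.IsSmooth) (hsc : ρ.IsSupercuspidal) {φ : Module.Dual ℂ V} (hφ : φ ∈ ρ.contragredient) (u : V)
    (x y : ↥(unitaryGroupOfForm (conjLocal L (IsCMField.complexConj L) v) (cmLocalForm L 2 v))) :
    ∫ n : ↥(cmBorelTriple L 2 v).N, ρ.matrixCoeff φ u (x * (n : ↥(unitaryGroupOfForm (conjLocal L (IsCMField.complexConj L) v) (cmLocalForm L 2 v)))⁻¹ * y) ∂ν = 0 :=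
  integral_matrixCoeff_translate_inv_eq_zero ρ (cmBorelTriple L 2 v).N ν hρ (isClosed_coe_cmBorelTriple_N L 2 v)
    (fun _ hC => cm_exists_compactOpen_subgroup_cmBorelN_two L v hns hC) (cm_forall_mem_span_sub_of_isSupercuspidal_two L v hns ρ hρ hsc) φ u
    (hsc.hasCompactSupport_matrixCoeff (isCompact_center_cmLocal_of_nonsplit L 2 v hns) hφ u) x y

/-- **THE TOKEN `hcu`, SESQUILINEAR CURRENCY** — for the coefficients `c_x(g) = B (ρ g u) x` of ★ p855471 `K2E1PoincareSeriesH1Package` (`B` a `G_v`-invariant Hermitian form):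
**`∀ x y, ∫_{N_v} B (ρ (x n⁻¹ y) u) u' dν(n) = 0`**, `v` non-split, `ρ` smooth supercuspidal, `ν` left-invariant finite on compacta.
[cite: HarishChandra1970, Part I §3 p. 9] [cite: Rogawski1990, §13.8 p. 218 (i)–(iii)] [cite: Gelbart1975, §10 p. 153] -/
theorem cm_integral_sesqForm_translate_inv_apply_cmBorelN_two_eq_zero (hns : ∀ w : PlacesOver L v, IsCMField.complexConj L • w.1 = w.1)
    [MeasurableSpace ↥(cmBorelTriple L 2 v).N] [BorelSpace ↥(cmBorelTriple L 2 v).N]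
    (ν : Measure ↥(cmBorelTriple L 2 v).N) [IsFiniteMeasureOnCompacts ν] [ν.IsMulLeftInvariant]
    {V : Type*} [AddCommGroup V] [Module ℂ V]
    (ρ : Representation ℂ ↥(unitaryGroupOfForm (conjLocal L (IsCMField.complexConj L) v) (cmLocalForm L 2 v)) V)
    {B : V →ₗ⋆[ℂ] V →ₗ[ℂ] ℂ} (hρ : ρ.IsSmooth) (hsc : ρ.IsSupercuspidal) (hBsymm : B.IsSymm) (hBinv : ∀ g (x w : V), B (ρ g x) (ρ g w) = B x w)
    (x y : ↥(unitaryGroupOfForm (conjLocal L (IsCMField.complexConj L) v) (cmLocalForm L 2 v))) (u u' : V) :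
    ∫ n : ↥(cmBorelTriple L 2 v).N, B (ρ (x * (n : ↥(unitaryGroupOfForm (conjLocal L (IsCMField.complexConj L) v) (cmLocalForm L 2 v)))⁻¹ * y) u) u' ∂ν = 0 :=
  integral_sesqForm_translate_inv_apply_eq_zero_of_isSupercuspidal ρ (cmBorelTriple L 2 v).N ν hρ hsc (isCompact_center_cmLocal_of_nonsplit L 2 v hns) hBsymm hBinv
    (isClosed_coe_cmBorelTriple_N L 2 v) (fun _ hC => cm_exists_compactOpen_subgroup_cmBorelN_two L v hns hC) (cm_forall_mem_span_sub_of_isSupercuspidal_two L v hns ρ hρ hsc) x y u u'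

/-- **The normalised idempotent `e = c · B(ρ(·)u) u` (★ p855188) has vanishing `N_v`-periods in the inverted form**: `∀ x y, ∫_{N_v} e (x n⁻¹ y) dν(n) = 0` (twin of ★ p855389
`integral_idempotent_translate_cmBorelN_two_eq_zero`, which is the form `x n y` against a right-invariant `μ`). [cite: HarishChandra1970, Part I §3 p. 9] [cite: Gelbart1975, §10 p. 153] -/
theorem cm_integral_idempotent_translate_inv_cmBorelN_two_eq_zero (hns : ∀ w : PlacesOver L v, IsCMField.complexConj L • w.1 = w.1)
    [MeasurableSpace ↥(cmBorelTriple L 2 v).N] [BorelSpace ↥(cmBorelTriple L 2 v).N]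
    (ν : Measure ↥(cmBorelTriple L 2 v).N) [IsFiniteMeasureOnCompacts ν] [ν.IsMulLeftInvariant]
    {V : Type*} [AddCommGroup V] [Module ℂ V]
    (ρ : Representation ℂ ↥(unitaryGroupOfForm (conjLocal L (IsCMField.complexConj L) v) (cmLocalForm L 2 v)) V)
    {B : V →ₗ⋆[ℂ] V →ₗ[ℂ] ℂ} (hρ : ρ.IsSmooth) (hsc : ρ.IsSupercuspidal) (hBsymm : B.IsSymm) (hBinv : ∀ g (x w : V), B (ρ g x) (ρ g w) = B x w)
    {u : V} {c : ℂ} {e : ↥(unitaryGroupOfForm (conjLocal L (IsCMField.complexConj L) v) (cmLocalForm L 2 v)) → ℂ} (he : ∀ g, e g = c * B (ρ g u) u)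
    (x y : ↥(unitaryGroupOfForm (conjLocal L (IsCMField.complexConj L) v) (cmLocalForm L 2 v))) :
    ∫ n : ↥(cmBorelTriple L 2 v).N, e (x * (n : ↥(unitaryGroupOfForm (conjLocal L (IsCMField.complexConj L) v) (cmLocalForm L 2 v)))⁻¹ * y) ∂ν = 0 := by
  simp_rw [he]
  rw [integral_const_mul, cm_integral_sesqForm_translate_inv_apply_cmBorelN_two_eq_zero L v hns ν ρ hρ hsc hBsymm hBinv x y u u, mul_zero]

end CM

end Summit.HodgeConjecture.HodgeConjecture.Cruxes.H413.K2E1SupercuspidalUnipotentPeriodVanishing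

end
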